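import Literature.MathematicalPhysics.QuantumFieldTheory.Balaban1983to89.Node00.TorusCoverLandau153
import Literature.MathematicalPhysics.QuantumFieldTheory.Balaban1983to89.Node00.TorusCoverSUGaugeLocal

/-!
# NODE 00 — [6] PROPOSITION 6's GAUGE AS AN `SU(N)` GAUGE ON THE WHOLE (1.131) TOWER `□₀ = ⋃_j □_j`, WITH [15] (152)'s LEVEL-WEIGHTED LETTERS
# «`Lʲη|A| < 9dL²B₁Mε₀` on `Ω′_j`» — the member-side extraction of generation 0's `exists_suGauge_letters152_153_of_gaugedBoundB8` RE-RUN ON `□₀` instead of the top box,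
# the `U(N) → SU(N)` normalisation done by the PER-BOND window of FILE 3b′ (`4·(N r) < 2π`, no width), height-uniform

Cell `pub-ymgap`, width seat `pub-ymgap-dag-n07-w3` generation 7 (sub-target S3 = [15] (145)–(156) at objects; CLAIM-5 ∕ INTENT-5, cell INBOX 2026-08-28).  NEW leaf;
CONSUMED BY NAME, nothing modified: generation 0's `Node00.TorusCoverLandau153` (`isLandau138_traceless`, `norm_lap_logCfg_le`) and its imports (dag-n07-e FILE 28a
`Node00.TorusCoverPropSixGauge`: `sideTouches_sq_top_of_mem_box`, `norm_sub_le_of_msup_grad`, `norm_codiff_logCfg_le`; FILE 3b `traceless`, `norm_traceless_le`,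
`norm_traceless_sub_le`, `pdiv_plaqCovDeriv_one_traceless`, `covLap_traceless`), this seat's FILE 3b′ `Node00.TorusCoverSUGaugeLocal` (`exists_suGauge_of_unitaryGauge_local`),
node00-def-cube's `Node00.GaugedBoundB8` (N05's Prop-6 member, conjuncts 2∕4∕5∕7∕9∕10), `B8Eq131Cubes` (`cube_eq`, `cube_subset_tcube`), `B8Eq131CubesAdmissible.cubeFam_false_zero`,
`B8Eq140Level.sideTouches_of_bondTouches`.  `--kind proof --supports stmt-QuantumFields-27364` (K1⁹; count-neutral helper).
[15] = [Balaban1985Variational]; [6] = [Balaban1985RegularSpaces]; [3] = [Balaban1985Averaging].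

WHY (LOCATED-LANDAU-REGION, dag-n07-w8 g6; LOCATED-SU-NORMALISATION-BELOW-TOP + its lift, this seat; cell INBOX 2026-08-28).  N05's member `GaugedBoundB8 L η V c r` carries
[6] (1.136) on the WHOLE tower: for every `j ≤ k` and every bond side-touching `□_j = c.sq j`, `U₁(b) = e^{iη·logCfg(b)}` with `‖logCfg(b)‖ ≤ r·(Lʲη)⁻¹` (conjunct 5) — print's
(152) with its weights; generation 0 extracted an `SU(N)` gauge with these letters on the TOP BOX only, because FILE 3b's normalisation window is width-dependent.  With FILE 3b′
the window is per-bond: on `□₀`'s bonds the angle is `η·N·‖logCfg‖ ≤ η·N·r·(L⁰η)⁻¹ = N·r`, so `4·(N r) < 2π` normalises the gauge on ALL of `□₀` at once.  THIS FILE: ★★★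
`exists_suGauge_letters152_tower_of_gaugedBoundB8` — ONE `SU(N)` gauge `s` on `ℤᵈ` and ONE potential `A′` (the traceless part of `logCfg η U₁`) with (i) the gauge equation
`V^{ιSU∘s}(b) = e^{iηA′(b)}` on EVERY bond of `□₀`; (ii) for every `j ≤ k`, `‖A′(b)‖ ≤ 2r·(Lʲη)⁻¹` on the bonds of `□_j` (both end-points in `□_j`); (iii) the top-box letters of
generation 0 verbatim (sup, gradient, `∂*∂`, `Δ` at weight `(Lᵏη)^{−1,−2,−3}` on `□`); (iv) the (153) gauge `IsLandau138 L k η □₀ Λ′ 1 A′`.  (i)+(ii) are what the `dist1`∕`B`-tower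
rows of [15] (154)–(156) and the S6 head's chart below the top box need (the Landau copy `U^{u}` defined with controlled fine bonds on all of `π(□₀)`); the torus push-down on the
tower windows is the next file of this lane.

WHAT IS PROVED (kernel; `𝔸 = M_N(ℂ)`, `N ≥ 1`, `d ≥ 2`; no definition).  `mem_sq_zero_iff_inBox` (the fine description of `□₀` as an `InBox`), `sideTouches_sq_of_mem`
(a bond of `□_j` side-touches `□_j`), ★★★ `exists_suGauge_letters152_tower_of_gaugedBoundB8`.
HONEST FRAMING: count-neutral member-side bookkeeping; [6] Prop. 6's conclusion at the member (`GaugedBoundB8`) is the HYPOTHESIS `hG` — N05's node, never proved here;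
NOTHING of [15]∕[6] analysis asserted; no token ∕ stub ∕ K-item closed; N07 ∕ N05 NOT discharged; counts unmoved; one finite 𝕋⁴ programme at fixed ε — R4 closes the
conditional finite-𝕋⁴ rung `BalabanLadder.UV` only; the YM mass gap (Clay) is NOT proved by any of this; nothing continuum ∕ ℝ⁴ ∕ OS.  No `sorry`, no `def`, no `instance`, no `notation`.

References: [Balaban1985RegularSpaces] Prop. 6 (1.135)–(1.138) p.99, (1.131) p.99, Thm 2 (1.36)–(1.38) p.82; [Balaban1985Variational] (144)–(153) pp.300–301; [Balaban1985Averaging] (9) p.18, p.20.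
-/

noncomputable section

namespace Literature.MathematicalPhysics.QuantumFieldTheory.Balaban1983to89.Node00

open scoped Matrix.Norms.L2Operator
open Complex (I)
open B7Prop1Explicit (e e_apply)
open B7Prop1Local (InBox AgreeOn)
open B7Prop2Explicit (unitaryUnits mem_unitaryUnits)
open B7Prop2SpecialUnitary (specialUnitaryUnits mem_specialUnitaryUnits)
open B8Ineq132 (covDerivFwd covDeriv BondTouches)
open B8Eq131Cubes (box cube tcube tLo tHi bLo bHi gs)
open B8Eq140Level (SideTouches sideTouches_of_bondTouches)
open B8Eq138LandauZd (logCfg covDivB covLap IsLandau138 IsLandau138W)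
open B8Eq184Proof (cfgExp)
open B8LeafModelZd3 (mlogCfg)
open B8ScaledSupNorm (msup Bdd bondNorm)
open B8Eq146AExpansion (plaqCovDeriv plaqCovDeriv_eq_covDerivFwd)
open B8Eq143PlaqExpansion (pdiv)

variable {d N : ℕ} [NeZero N]

section Tower

variable {L K : ℕ} {Ω : ℕ → Set (B7Prop1Explicit.Site d)}

omit [NeZero N] in
/-- **`□₀` AS A BOX OF `ℤᵈ`**: `x ∈ c.sq 0 ↔ InBox (bLo L a k (ρ·gs L k)) (bHi L a M k (ρ·gs L k)) x` — the fine description (margin `ρ·Σ_{i≤k} Lⁱ`) of the largest cube of the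
(1.131) tower. [cite: Balaban1985RegularSpaces, (1.131) p.99, p.98] -/
theorem mem_sq_zero_iff_inBox (c : CubeB8 d L K Ω) (x : B7Prop1Explicit.Site d) :
    x ∈ c.sq 0 ↔ InBox (bLo L c.a c.k (c.ρ * gs L c.k)) (bHi L c.a c.M c.k (c.ρ * gs L c.k)) x := by
  have h : c.sq 0 = cube L c.a c.M c.ρ c.k 0 := B8Eq131CubesAdmissible.cubeFam_false_zero L c.a c.M c.ρ c.k
  rw [h, B8Eq131Cubes.cube_eq (Nat.zero_le _)]
  simp only [pow_zero, one_mul, Nat.sub_zero, Set.mem_setOf_eq]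

omit [NeZero N] in
/-- **A bond with both end-points in `□_j` side-touches `□_j`** (`d ≥ 2` supplies the second direction of the p. 77 side convention). [cite: Balaban1985RegularSpaces, (1.131) p.99, p.77] -/
theorem sideTouches_sq_of_mem (hd : 2 ≤ d) (c : CubeB8 d L K Ω) (j : ℕ) {x : B7Prop1Explicit.Site d} (hx : x ∈ c.sq j) (μ : Fin d) :
    SideTouches (c.sq j) x μ := by
  obtain ⟨κ, hκ⟩ : ∃ κ : Fin d, κ ≠ μ := by
    by_cases h0 : μ.val = 0
    · exact ⟨⟨1, by omega⟩, fun h => by have := congrArg Fin.val h; simp at this; omega⟩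
    · exact ⟨⟨0, by omega⟩, fun h => by have := congrArg Fin.val h; simp at this; omega⟩
  exact sideTouches_of_bondTouches hκ (Or.inl hx)

/-- ★★★ **[6] PROPOSITION 6's GAUGE AS AN `SU(N)` GAUGE ON THE WHOLE TOWER `□₀`, WITH (152)'s LEVEL-WEIGHTED LETTERS** — generation 0's
`exists_suGauge_letters152_153_of_gaugedBoundB8` re-run on `□₀ = c.sq 0` with the normalisation of FILE 3b′ (per-bond window `4·(N r) < 2π`, NO width).  Hypotheses: `d ≥ 2`,
`L ≥ 2`, a cube datum `c`, `V` `SU(N)`-valued, `η > 0`, `r ≥ 0`, `GaugedBoundB8 L η V c r` (the HYPOTHESIS — N05's node), `4·(N·r) < 2π`.  Conclusions, for ONE `s : ℤᵈ → SU(N)`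
and ONE `A′`: (i) `V^{ιSU∘s}(b) = cfgExp η A′ b` on every bond of `□₀`; (ii) `∀ j ≤ k`, `‖A′(b)‖ ≤ 2·(r·(Lʲη)⁻¹)` on every bond with both end-points in `□_j` ([15] (152) «on Ω′_j»);
(iii) on the top box `□`: sup `≤ 2r(Lᵏη)⁻¹`, gradients `≤ 2ηr(Lᵏη)⁻²`, `∂*∂` and `Δ` `≤ 2r(Lᵏη)⁻³` (generation 0 verbatim); (iv) `IsLandau138 L k η □₀ Λ′ 1 A′`.
[cite: Balaban1985RegularSpaces, Prop. 6 (1.135)–(1.138) p.99, (1.131) p.99; Balaban1985Variational, (144)–(153) pp.300–301; Balaban1985Averaging, (9) p.18, p.20] -/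
theorem exists_suGauge_letters152_tower_of_gaugedBoundB8 (hd : 2 ≤ d) (hL : 2 ≤ L) (c : CubeB8 d L K Ω)
    (V : B7Prop1Explicit.Site d → Fin d → (MatA N)ˣ) (hV : ∀ x μ, V x μ ∈ specialUnitaryUnits (Fin N)) {η r : ℝ} (hη : 0 < η) (hr : 0 ≤ r)
    (hG : letI : CStarAlgebra (MatA N) := {}; GaugedBoundB8 L η V c r)
    (hsmall : 4 * ((N : ℝ) * r) < 2 * Real.pi) :
    ∃ s : B7Prop1Explicit.Site d → Matrix.specialUnitaryGroup (Fin N) ℂ, ∃ A' : B7Prop1Explicit.Site d → Fin d → MatA N,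
      (∀ x μ, x ∈ c.sq 0 → x + e μ ∈ c.sq 0 →
          B7Prop1Explicit.gaugeAct (fun y => ιSU N (s y)) V x μ = cfgExp η A' x μ) ∧
      (∀ j, j ≤ c.k → ∀ x μ, x ∈ c.sq j → x + e μ ∈ c.sq j → ‖A' x μ‖ ≤ 2 * (r * ((L : ℝ) ^ j * η)⁻¹)) ∧
      (∀ x μ, x ∈ box L c.a c.M c.k → x + e μ ∈ box L c.a c.M c.k → ‖A' x μ‖ ≤ 2 * (r * ((L : ℝ) ^ c.k * η)⁻¹)) ∧
      (∀ x μ ν, x ∈ box L c.a c.M c.k → x + e μ ∈ box L c.a c.M c.k → x + e ν ∈ box L c.a c.M c.k →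
          ‖A' (x + e μ) ν - A' x ν‖ ≤ 2 * (η * r * (((L : ℝ) ^ c.k * η) ^ 2)⁻¹)) ∧
      (∀ x μ, x ∈ box L c.a c.M c.k → x + e μ ∈ box L c.a c.M c.k →
          (∀ ν, x + e ν ∈ box L c.a c.M c.k ∧ x - e ν ∈ box L c.a c.M c.k ∧ x - e ν + e μ ∈ box L c.a c.M c.k) →
          ‖pdiv η (1 : B7Prop1Explicit.Site d → Fin d → (MatA N)ˣ) (plaqCovDeriv η 1 A') μ x‖ ≤ 2 * (r * (((L : ℝ) ^ c.k * η) ^ 3)⁻¹)) ∧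
      (∀ x μ, x ∈ box L c.a c.M c.k → x + e μ ∈ box L c.a c.M c.k → (∀ ν, x + e ν ∈ box L c.a c.M c.k ∧ x - e ν ∈ box L c.a c.M c.k) →
          ‖covLap η (1 : B7Prop1Explicit.Site d → Fin d → (MatA N)ˣ) (fun z => A' z μ) x‖ ≤ 2 * (r * (((L : ℝ) ^ c.k * η) ^ 3)⁻¹)) ∧
      IsLandau138 L c.k η (c.sq 0) c.lamS (1 : B7Prop1Explicit.Site d → Fin d → (MatA N)ˣ) A' := by
  letI : CStarAlgebra (MatA N) := {}
  have hL1 : 1 ≤ L := le_trans (by norm_num) hL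
  have hρ1 : 1 ≤ c.ρ := le_trans hL1 c.L_le_ρ
  obtain ⟨u, hu, -, -, h138, h162, hw, h135, h136₂, h136₃, h136₄, -⟩ := hG
  set w : B7Prop1Explicit.Site d → (MatA N)ˣ := (c.vfix V)⁻¹ * u with hwdef
  set U₁ : B7Prop1Explicit.Site d → Fin d → (MatA N)ˣ := c.fixed V u with hU₁
  have h138' : IsLandau138 L c.k η (c.sq 0) c.lamS (1 : B7Prop1Explicit.Site d → Fin d → (MatA N)ˣ) (logCfg η U₁) := h138
  have h136' : ∀ j, j ≤ c.k → ∀ b ∈ {b : B7Prop1Explicit.Site d × Fin d | SideTouches (c.sq j) b.1 b.2},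
      ‖logCfg η U₁ b.1 b.2‖ ≤ r * ((L : ℝ) ^ j * η)⁻¹ := fun j hj b hb => (h162 j hj b hb).2.2
  -- `□₀` as an `InBox`, inside `□̃`
  set lo₀ : B7Prop1Explicit.Site d := bLo L c.a c.k (c.ρ * gs L c.k) with hlo₀
  set hi₀ : B7Prop1Explicit.Site d := bHi L c.a c.M c.k (c.ρ * gs L c.k) with hhi₀
  have hsq : ∀ x, InBox lo₀ hi₀ x ↔ x ∈ c.sq 0 := fun x => (mem_sq_zero_iff_inBox c x).symm
  have hsqT : c.sq 0 ⊆ tcube L c.a c.M c.ρ c.k := by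
    have h0 : c.sq 0 = cube L c.a c.M c.ρ c.k 0 := B8Eq131CubesAdmissible.cubeFam_false_zero L c.a c.M c.ρ c.k
    rw [h0]
    exact B8Eq131Cubes.cube_subset_tcube hL hρ1 (Nat.zero_le _)
  -- the data of FILE 3b′'s normalisation on the box `□₀`
  have hg : ∀ x, InBox lo₀ hi₀ x → w⁻¹ x ∈ unitaryUnits (MatA N) := fun x _ => by
    rw [Pi.inv_apply]; exact (unitaryUnits (MatA N)).inv_mem (hw x)
  have hgauge : ∀ x μ, InBox lo₀ hi₀ x → InBox lo₀ hi₀ (x + e μ) → B7Prop1Explicit.gaugeAct w⁻¹ V x μ = cfgExp η (logCfg η U₁) x μ := by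
    intro x μ hx hx'
    have hx0 := (hsq x).1 hx
    rw [h135 x μ (hsqT hx0) (hsqT ((hsq _).1 hx'))]
    exact (h162 0 (Nat.zero_le _) (x, μ) (sideTouches_sq_of_mem hd c 0 hx0 μ)).1
  have hsa : ∀ x μ, InBox lo₀ hi₀ x → InBox lo₀ hi₀ (x + e μ) → IsSelfAdjoint (logCfg η U₁ x μ) := fun x μ hx _ =>
    (h162 0 (Nat.zero_le _) (x, μ) (sideTouches_sq_of_mem hd c 0 ((hsq x).1 hx) μ)).2.1
  have hA : ∀ x μ, InBox lo₀ hi₀ x → InBox lo₀ hi₀ (x + e μ) → η * (N * ‖logCfg η U₁ x μ‖) ≤ N * r := by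
    intro x μ hx _
    have h := h136' 0 (Nat.zero_le _) (x, μ) (sideTouches_sq_of_mem hd c 0 ((hsq x).1 hx) μ)
    simp only [pow_zero, one_mul] at h
    have hN : (0 : ℝ) ≤ N := Nat.cast_nonneg N
    calc η * (N * ‖logCfg η U₁ x μ‖) ≤ η * (N * (r * η⁻¹)) := mul_le_mul_of_nonneg_left (mul_le_mul_of_nonneg_left h hN) hη.le
      _ = N * r := by field_simp
  have hVdet : ∀ x μ, InBox lo₀ hi₀ x → InBox lo₀ hi₀ (x + e μ) → ((V x μ : (MatA N)ˣ) : MatA N).det = 1 := fun x μ _ _ =>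
    (Matrix.mem_specialUnitaryGroup_iff.1 (hV x μ)).2
  obtain ⟨s, hs⟩ := exists_suGauge_of_unitaryGauge_local lo₀ hi₀ hη.le V w⁻¹ (logCfg η U₁) hVdet hg hgauge hsa hA hsmall
  -- top-box letters (generation 0, verbatim)
  have hAtop : ∀ x μ, InBox (bLo L c.a c.k 0) (bHi L c.a c.M c.k 0) x → InBox (bLo L c.a c.k 0) (bHi L c.a c.M c.k 0) (x + e μ) →
      ‖logCfg η U₁ x μ‖ ≤ r * ((L : ℝ) ^ c.k * η)⁻¹ := fun x μ hx _ => h136' c.k le_rfl (x, μ) (sideTouches_sq_top_of_mem_box c hd hx μ)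
  refine ⟨s, fun y ν => traceless (logCfg η U₁ y ν), fun x μ hx hx' => hs x μ ((hsq x).2 hx) ((hsq _).2 hx'), fun j hj x μ hx hx' => ?_,
    fun x μ hx hx' => ?_, fun x μ ν hx hx' _ => ?_, fun x μ hx hx' hν => ?_, fun x μ hx _ hν => ?_, isLandau138_traceless h138'⟩
  · exact (norm_traceless_le _).trans (mul_le_mul_of_nonneg_left (h136' j hj (x, μ) (sideTouches_sq_of_mem hd c j hx μ)) (by norm_num))
  · exact (norm_traceless_le _).trans (mul_le_mul_of_nonneg_left (hAtop x μ hx hx') (by norm_num))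
  · exact (norm_traceless_sub_le _ _).trans
      (mul_le_mul_of_nonneg_left (norm_sub_le_of_msup_grad c hd hL1 hη hr U₁ h136' h136₂ hx hx') (by norm_num))
  · rw [pdiv_plaqCovDeriv_one_traceless]
    exact (norm_traceless_le _).trans (mul_le_mul_of_nonneg_left (norm_codiff_logCfg_le c hd hL1 hη hr U₁ h136' h136₃ hx hx' hν) (by norm_num))
  · rw [covLap_traceless]
    exact (norm_traceless_le _).trans (mul_le_mul_of_nonneg_left (norm_lap_logCfg_le c hd hL1 hη hr U₁ h136' h136₄ hx hν μ) (by norm_num))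

end Tower

end Literature.MathematicalPhysics.QuantumFieldTheory.Balaban1983to89.Node00

end
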